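import Summits.NavierStokesRegularity.NavierStokesRegularity.Theorems.PoloidalWindowDoorPoloidalWindowRigidityZShockPSystemBackwardBudget
import Summits.NavierStokesRegularity.NavierStokesRegularity.Theorems.PoloidalWindowDoorPoloidalWindowRigidityZShockBudgetConvergence
import HarnessLib

/-!
# Crux K2 `PoloidalWindowRigidity` (stmt-NavierStokesRegularity-19708), line `z_shock` — ★ RUNG R2 UNDER NON-UNIFORM GENUINE
# NONLINEARITY, HYPOTHESIS-FREE FORM: no forward Riemann invariant can have a positive transversal derivative (Lemma A)

`--supports stmt-NavierStokesRegularity-19708 --as helper` (leafhand-ns-poloidalwindowdoor-3 g2, cell decomp-ns, 2026-08-31).  Class-free,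
Mathlib + tree files only.  **No stub and no summit is closed by this file; Navier–Stokes regularity is NOT proved here (rung 0).**

This is Lemma A of the complete proof of «R2 with NON-uniform genuine nonlinearity» (evidence memo `R2-NONUNIFORM-leafhand-3-g2.md` v4
on the crux item; steps (a) budget = `…PSystemBackwardBudget` p822821, (b) convergence = `…BudgetConvergence` p822978).  For a `C²`
solution `(w, p)` of the autonomous p-system `p_z = −κ(w)² w_x`, `w_z = −p_x` on `ℝ × ℝ` (two-sided in the height `z`), with `w`,
`w_x`, `w_z` bounded, `0 < κlo ≤ κ(w) ≤ κhi` and `|κ'(w)| ≤ k₁` along the solution, `κ > 0`, `κ' ≥ 0`, `κ'` continuous and NOT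
identically zero on any nontrivial interval (strict monotonicity of the characteristic speed — the linearly degenerate case
genuinely admits travelling waves), the forward Riemann invariant `r = p + K(w)` has `r_x ≤ 0` EVERYWHERE (`no_pos_forward_gradient`).
No uniform lower bound `κ' ≥ k₀ > 0` and no recurrence hypothesis is assumed.

Proof (all in this file, on top of the two imported bricks): if `r_x(z₀, x₀) > 0` then `r_x(z₀, ·) > 0` near `x₀`; for `x ≤ x₀` near
`x₀` let `X_x` be the global forward characteristic through `(z₀, x)` (`r ≡ r(z₀, x)` on it).  (a)+(b): `w ∘ X_x` converges as
`z → −∞` to a value `d_x` with `κ'(d_x) = 0`.  (c) forward characteristics do not cross (ODE uniqueness), so `X_x ≤ X_{x₀}`; the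
backward characteristic through `(z, X_x z)` meets `X_{x₀}` at a height `t* ≤ z` (relative speed `≥ 2κlo`), and `s = p − K(w)` is
constant along it, so `s(z, X_x z) → σ := r(z₀, x₀) − 2K(d_{x₀})`.  (d) Hence `2K(d_x) = r(z₀, x) − σ`; as `x` runs over an
interval, `K(d_x)` runs over an interval, so the degenerate values `d_x` fill a nontrivial interval — contradicting the hypothesis on
`κ'`.  The symmetric statements (`r_x ≥ 0`, `s_x = 0`) and the constancy of `(w, p)` follow by the reflections
`(z, x) ↦ (−z, −x)` and `x ↦ −x, p ↦ −p` (sequel file). [folklore] (Lax 1964; John 1974; Klainerman–Majda 1980 for the degenerate string)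
-/

noncomputable section

namespace Summit.NavierStokesRegularity.NavierStokesRegularity.Theorems.PoloidalWindowDoorPoloidalWindowRigidityZShockPSystemNonuniform

-- the summit and its single sub-problem share the name (CONVENTIONS §1)
set_option linter.dupNamespace false

open Set Filter Topology Function Metric
open scoped NNReal
open Summit.NavierStokesRegularity.NavierStokesRegularity.Theorems.PoloidalWindowDoorPoloidalWindowRigidityZShockCharacteristicRiccati
open Summit.NavierStokesRegularity.NavierStokesRegularity.Theorems.PoloidalWindowDoorPoloidalWindowRigidityZShockGlobalCharacteristics
open Summit.NavierStokesRegularity.NavierStokesRegularity.Theorems.PoloidalWindowDoorPoloidalWindowRigidityZShockPSystemBackwardBudget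
open Summit.NavierStokesRegularity.NavierStokesRegularity.Theorems.PoloidalWindowDoorPoloidalWindowRigidityZShockBudgetConvergence

/-! ## Three small tools: invariance along a characteristic, non-crossing, crossing height -/

/-- A quantity transported by `F_z + c F_x = 0` is constant along every `c`-characteristic. [folklore] -/
theorem const_along {F c : ℝ × ℝ → ℝ} (hF : Differentiable ℝ F)
    (hPDE : ∀ q, fderiv ℝ F q (1, 0) + c q * fderiv ℝ F q (0, 1) = 0)
    {X : ℝ → ℝ} (hX : ∀ z, HasDerivAt X (c (z, X z)) z) : ∀ t t', F (t, X t) = F (t', X t') := by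
  have hd : ∀ z, HasDerivAt (fun t => F (t, X t)) 0 z := by
    intro z
    have h := hasDerivAt_along (hF (z, X z)) (hX z)
    rwa [hPDE] at h
  exact is_const_of_deriv_eq_zero (fun z => (hd z).differentiableAt) (fun z => (hd z).deriv)

/-- Two solutions of the same `x`-Lipschitz characteristic ODE that are ordered at one height are ordered at every height
(uniqueness: they never meet unless equal). [folklore] -/
theorem le_of_le_char {F : ℝ → ℝ → ℝ} {K : ℝ≥0} (hK : ∀ z, LipschitzWith K (F z)) {X Y : ℝ → ℝ}
    (hX : ∀ z, HasDerivAt X (F z (X z)) z) (hY : ∀ z, HasDerivAt Y (F z (Y z)) z) {z₀ : ℝ} (h0 : X z₀ ≤ Y z₀) :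
    ∀ z, X z ≤ Y z := by
  by_contra hnot
  push Not at hnot
  obtain ⟨z₁, hz₁⟩ := hnot
  -- `X - Y` is continuous, `≤ 0` at `z₀`, `> 0` at `z₁`: it vanishes somewhere, hence `X = Y`
  have hc : Continuous fun z => X z - Y z :=
    (continuous_iff_continuousAt.2 fun z => (hX z).continuousAt).sub
      (continuous_iff_continuousAt.2 fun z => (hY z).continuousAt)
  have hex : ∃ z₂, X z₂ = Y z₂ := by
    have h1 : X z₀ - Y z₀ ≤ 0 := by linarith
    have h2 : 0 ≤ X z₁ - Y z₁ := by linarith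
    rcases le_total z₀ z₁ with hle | hle
    · obtain ⟨z₂, -, hz₂⟩ := intermediate_value_Icc hle hc.continuousOn ⟨h1, h2⟩
      exact ⟨z₂, by linarith⟩
    · obtain ⟨z₂, -, hz₂⟩ := intermediate_value_Icc' hle hc.continuousOn ⟨h1, h2⟩
      exact ⟨z₂, by linarith⟩
  obtain ⟨z₂, hz₂⟩ := hex
  have hEq : X = Y :=
    ODE_solution_unique_univ (v := F) (s := fun _ => univ) (fun z => (hK z).lipschitzOnWith)
      (fun z => ⟨hX z, mem_univ _⟩) (fun z => ⟨hY z, mem_univ _⟩) hz₂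
  rw [hEq] at hz₁
  exact lt_irrefl _ hz₁

/-- **Crossing height.**  A forward characteristic `X` (speed `≥ κlo > 0`) and a backward one `Y` (speed `≤ −κlo`) with `Y z ≤ X z`
meet at some height `t* ≤ z`. [folklore] -/
theorem exists_crossing_below {X Y cX cY : ℝ → ℝ} {κlo z : ℝ} (hκlo : 0 < κlo)
    (hX : ∀ t, HasDerivAt X (cX t) t) (hY : ∀ t, HasDerivAt Y (cY t) t)
    (hcX : ∀ t, κlo ≤ cX t) (hcY : ∀ t, cY t ≤ -κlo) (hle : Y z ≤ X z) :
    ∃ t ≤ z, X t = Y t := by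
  set E : ℝ → ℝ := fun t => X t - Y t with hE
  have hEd : ∀ t, HasDerivAt E (cX t - cY t) t := fun t => (hX t).sub (hY t)
  have hEc : Continuous E := continuous_iff_continuousAt.2 fun t => (hEd t).continuousAt
  set t₁ : ℝ := z - (E z) / (2 * κlo) - 1 with ht₁
  have hEz : 0 ≤ E z := by simp only [hE]; linarith
  have ht₁z : t₁ ≤ z := by
    have : 0 ≤ E z / (2 * κlo) := by positivity
    rw [ht₁]; linarith
  -- `E` grows at rate `≥ 2κlo`, so `E t₁ ≤ E z - 2κlo (z - t₁) < 0`
  have hincr : 2 * κlo * (z - t₁) ≤ E z - E t₁ :=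
    mul_sub_le_sub_of_deriv_ge ht₁z (fun t _ => hEd t) fun t _ => by linarith [hcX t, hcY t]
  have hEt₁ : E t₁ ≤ 0 := by
    have : 2 * κlo * (z - t₁) = E z + 2 * κlo := by rw [ht₁]; field_simp; ring
    linarith
  obtain ⟨t, ht, hEt⟩ := intermediate_value_Icc ht₁z hEc.continuousOn ⟨hEt₁, hEz⟩
  exact ⟨t, ht.2, by simpa [hE, sub_eq_zero] using hEt⟩

/-! ## Lemma A: no positive forward gradient -/

/-- **★ Lemma A (R2, non-uniform genuine nonlinearity).**  Under the standing hypotheses of the module docstring, the forward Riemann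
invariant `r = p + K(w)` satisfies `r_x = p_x + κ(w) w_x ≤ 0` at EVERY point. [folklore] -/
theorem no_pos_forward_gradient {w p : ℝ × ℝ → ℝ} {κ κ' K : ℝ → ℝ} (hw : ContDiff ℝ 2 w) (hp : ContDiff ℝ 2 p)
    (hK2 : ContDiff ℝ 2 K) (hKd : ∀ v, HasDerivAt K (κ v) v) (hκd : ∀ v, HasDerivAt κ (κ' v) v) (hκ'c : Continuous κ')
    (hsys1 : ∀ q, fderiv ℝ p q (1, 0) = -(κ (w q) ^ 2 * fderiv ℝ w q (0, 1)))
    (hsys2 : ∀ q, fderiv ℝ w q (1, 0) = -fderiv ℝ p q (0, 1))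
    {κlo κhi k₁ W₁ W₂ Mw : ℝ} (hκlo0 : 0 < κlo) (hκlo : ∀ q, κlo ≤ κ (w q)) (hκhi : ∀ q, κ (w q) ≤ κhi)
    (hκpos : ∀ v, 0 < κ v) (hgnl : ∀ v, 0 ≤ κ' v) (hgn : ∀ a b : ℝ, a < b → ∃ v ∈ Ioo a b, κ' v ≠ 0)
    (hk₁ : ∀ q, |κ' (w q)| ≤ k₁) (hW₁ : ∀ q, |fderiv ℝ w q (0, 1)| ≤ W₁) (hW₂ : ∀ q, |fderiv ℝ w q (1, 0)| ≤ W₂)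
    (hMw : ∀ q, |w q| ≤ Mw) :
    ∀ q : ℝ × ℝ, fderiv ℝ p q (0, 1) + κ (w q) * fderiv ℝ w q (0, 1) ≤ 0 := by
  have hw1 : Differentiable ℝ w := hw.differentiable (by simp)
  have hp1 : Differentiable ℝ p := hp.differentiable (by simp)
  have hκ1 : Differentiable ℝ κ := fun v => (hκd v).differentiableAt
  have hK1 : Differentiable ℝ K := fun v => (hKd v).differentiableAt
  have hKc : Continuous K := hK1.continuous
  have hκpos' : ∀ q, 0 < κ (w q) := fun q => hκlo0.trans_le (hκlo q)
  have hκhi0 : 0 < κhi := hκlo0.trans_le ((hκlo 0).trans (hκhi 0))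
  have hW₁0 : 0 ≤ W₁ := (abs_nonneg _).trans (hW₁ 0)
  have hW₂0 : 0 ≤ W₂ := (abs_nonneg _).trans (hW₂ 0)
  have hk₁0 : 0 ≤ k₁ := (abs_nonneg _).trans (hk₁ 0)
  -- `K` is strictly increasing
  have hKmono : StrictMono K := strictMono_of_deriv_pos fun v => by rw [(hKd v).deriv]; exact hκpos v
  -- Riemann invariants and their transport equations
  set r : ℝ × ℝ → ℝ := fun q => p q + K (w q) with hrdef
  set s : ℝ × ℝ → ℝ := fun q => p q - K (w q) with hsdef
  have hKw : ∀ q, HasFDerivAt (fun q' => K (w q')) (κ (w q) • fderiv ℝ w q) q :=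
    fun q => (hKd (w q)).comp_hasFDerivAt q (hw1 q).hasFDerivAt
  have hrF : ∀ q, HasFDerivAt r (fderiv ℝ p q + κ (w q) • fderiv ℝ w q) q :=
    fun q => (hp1 q).hasFDerivAt.add (hKw q)
  have hsF : ∀ q, HasFDerivAt s (fderiv ℝ p q - κ (w q) • fderiv ℝ w q) q :=
    fun q => (hp1 q).hasFDerivAt.sub (hKw q)
  have hr1 : Differentiable ℝ r := fun q => (hrF q).differentiableAt
  have hs1 : Differentiable ℝ s := fun q => (hsF q).differentiableAt
  have hr2 : ContDiff ℝ 2 r := hp.add (hK2.comp hw)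
  have hrD : ∀ q v, fderiv ℝ r q v = fderiv ℝ p q v + κ (w q) * fderiv ℝ w q v := by
    intro q v; rw [(hrF q).fderiv]; simp [smul_eq_mul]
  have hsD : ∀ q v, fderiv ℝ s q v = fderiv ℝ p q v - κ (w q) * fderiv ℝ w q v := by
    intro q v; rw [(hsF q).fderiv]; simp [smul_eq_mul]
  have hPDE1 : ∀ q, fderiv ℝ r q (1, 0) + (fun q => κ (w q)) q * fderiv ℝ r q (0, 1) = 0 := by
    intro q; rw [hrD, hrD, hsys1, hsys2]; ring
  have hPDE2 : ∀ q, fderiv ℝ s q (1, 0) + (fun q => -κ (w q)) q * fderiv ℝ s q (0, 1) = 0 := by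
    intro q; rw [hsD, hsD, hsys1, hsys2]; ring
  -- `2 K(w) = r - s`
  have hKrs : ∀ q, 2 * K (w q) = r q - s q := fun q => by simp only [hrdef, hsdef]; ring
  -- the speed is Lipschitz in `x`, uniformly in `z`; global characteristics of both families
  have hκw : ∀ q, HasFDerivAt (fun q' => κ (w q')) (κ' (w q) • fderiv ℝ w q) q :=
    fun q => (hκd (w q)).comp_hasFDerivAt q (hw1 q).hasFDerivAt
  have hsl : ∀ (σ z x : ℝ), HasDerivAt (fun x' => σ * κ (w (z, x'))) (σ * (κ' (w (z, x)) * fderiv ℝ w (z, x) (0, 1))) x := by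
    intro σ z x
    have hγ : HasDerivAt (fun x' : ℝ => ((z, x') : ℝ × ℝ)) ((0 : ℝ), (1 : ℝ)) x :=
      (hasDerivAt_const x z).prodMk (hasDerivAt_id x)
    have h1 : HasDerivAt (fun x' => κ (w (z, x'))) ((κ' (w (z, x)) • fderiv ℝ w (z, x)) ((0 : ℝ), (1 : ℝ))) x :=
      (hκw (z, x)).comp_hasDerivAt x hγ
    simpa [smul_eq_mul] using h1.const_mul σ
  have hLip : ∀ σ : ℝ, (σ = 1 ∨ σ = -1) → ∀ z, LipschitzWith (Real.toNNReal (k₁ * W₁)) (fun x => σ * κ (w (z, x))) := by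
    intro σ hσ z
    have hσ1 : |σ| = 1 := by rcases hσ with h | h <;> simp [h]
    refine lipschitzWith_of_nnnorm_deriv_le (fun x => (hsl σ z x).differentiableAt) fun x => ?_
    rw [(hsl σ z x).deriv, ← NNReal.coe_le_coe, coe_nnnorm, Real.coe_toNNReal _ (mul_nonneg hk₁0 hW₁0),
      Real.norm_eq_abs, abs_mul, hσ1, one_mul, abs_mul]
    exact mul_le_mul (hk₁ _) (hW₁ _) (abs_nonneg _) hk₁0
  have hchar : ∀ σ : ℝ, (σ = 1 ∨ σ = -1) → ∀ z₀ x₀ : ℝ, ∃ X : ℝ → ℝ, X z₀ = x₀ ∧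
      ∀ z, HasDerivAt X (σ * κ (w (z, X z))) z := by
    intro σ hσ z₀ x₀
    have hσ1 : |σ| = 1 := by rcases hσ with h | h <;> simp [h]
    refine exists_global_solution (F := fun z x => σ * κ (w (z, x))) (K := Real.toNNReal (k₁ * W₁))
      (B := Real.toNNReal κhi) (hLip σ hσ) (fun x => ?_) (fun z x => ?_) z₀ x₀
    · exact continuous_const.mul (hκ1.continuous.comp (hw1.continuous.comp (continuous_id.prodMk continuous_const)))
    · rw [Real.norm_eq_abs, abs_mul, hσ1, one_mul, abs_of_pos (hκpos' _), Real.coe_toNNReal _ hκhi0.le]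
      exact hκhi _
  -- (a)+(b) along ANY forward characteristic through a point with `r_x > 0`: `w` converges to a degenerate value
  have hconv : ∀ (X : ℝ → ℝ) (z₀ : ℝ), (∀ z, HasDerivAt X (κ (w (z, X z))) z) →
      0 < fderiv ℝ p (z₀, X z₀) (0, 1) + κ (w (z₀, X z₀)) * fderiv ℝ w (z₀, X z₀) (0, 1) →
      ∃ d, Tendsto (fun z => w (z, X z)) atBot (𝓝 d) ∧ κ' d = 0 := by
    intro X z₀ hX hpos
    have hXc : Continuous X := continuous_iff_continuousAt.2 fun z => (hX z).continuousAt
    -- the antiderivative of `κ'(w ∘ X)`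
    have hic : Continuous fun t => κ' (w (t, X t)) :=
      hκ'c.comp (hw1.continuous.comp (continuous_id.prodMk hXc))
    set A : ℝ → ℝ := fun z => ∫ t in z₀..z, κ' (w (t, X t)) with hAdef
    have hA : ∀ z, HasDerivAt A (κ' (w (z, X z))) z := fun z => (hic.integral_hasStrictDerivAt z₀ z).hasDerivAt
    -- (a) the budget
    have hbud : ∀ z ≤ z₀, A z₀ - A z ≤ 2 * κhi * Real.exp (|Real.log κlo| + |Real.log κhi|) /
        (fderiv ℝ p (z₀, X z₀) (0, 1) + κ (w (z₀, X z₀)) * fderiv ℝ w (z₀, X z₀) (0, 1)) :=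
      fun z hz => (pSystem_backward_budget hw hp hK2 hKd hκd hsys1 hsys2 hκlo0 hκlo hκhi (fun q => hgnl _) hX hA hz hpos).le
    -- `w ∘ X` is Lipschitz
    have hg : ∀ z, HasDerivAt (fun t => w (t, X t))
        (fderiv ℝ w (z, X z) (1, 0) + κ (w (z, X z)) * fderiv ℝ w (z, X z) (0, 1)) z :=
      fun z => hasDerivAt_along (hw1 (z, X z)) (hX z)
    have hg' : ∀ z, |fderiv ℝ w (z, X z) (1, 0) + κ (w (z, X z)) * fderiv ℝ w (z, X z) (0, 1)| ≤ W₂ + κhi * W₁ + 1 := by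
      intro z
      have h1 := hW₂ (z, X z)
      have h2 := hW₁ (z, X z)
      have h3 : |κ (w (z, X z)) * fderiv ℝ w (z, X z) (0, 1)| ≤ κhi * W₁ := by
        rw [abs_mul, abs_of_pos (hκpos' _)]
        exact mul_le_mul (hκhi _) h2 (abs_nonneg _) hκhi0.le
      linarith [abs_add_le (fderiv ℝ w (z, X z) (1, 0)) (κ (w (z, X z)) * fderiv ℝ w (z, X z) (0, 1))]
    have hL : 0 < W₂ + κhi * W₁ + 1 := by positivity
    obtain ⟨d, hd⟩ := exists_tendsto_atBot_of_budget (m := -Mw) (M := Mw) hL hg hg'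
      (fun z => by have := hMw (z, X z); have := neg_abs_le (w (z, X z)); linarith)
      (fun z => (le_abs_self _).trans (hMw (z, X z))) hκ'c (fun z => hgnl _) hgn hA hbud
    exact ⟨d, hd, apply_eq_zero_of_tendsto_of_budget hκ'c (fun z => hgnl _) hA hbud hd⟩
  -- now suppose `r_x > 0` somewhere
  intro q₀
  by_contra hpos'
  have hpos : 0 < fderiv ℝ r q₀ (0, 1) := by rw [hrD]; exact not_le.1 hpos'
  obtain ⟨z₀, x₀⟩ := q₀
  -- `r_x (z₀, ·) > 0` on a neighbourhood of `x₀`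
  have hrxc : Continuous fun x => fderiv ℝ r (z₀, x) (0, 1) :=
    ((hr2.continuous_fderiv (by simp)).comp (continuous_const.prodMk continuous_id)).clm_apply continuous_const
  obtain ⟨ε, hε, hball⟩ : ∃ ε > 0, ∀ x, dist x x₀ < ε → 0 < fderiv ℝ r (z₀, x) (0, 1) := by
    have hopen : IsOpen {x : ℝ | 0 < fderiv ℝ r (z₀, x) (0, 1)} := isOpen_lt continuous_const hrxc
    obtain ⟨ε, hε, hsub⟩ := Metric.isOpen_iff.1 hopen x₀ hpos
    exact ⟨ε, hε, fun x hx => hsub hx⟩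
  -- the reference characteristic `X₀` through `(z₀, x₀)` and its limit data
  obtain ⟨X₀, hX₀0, hX₀⟩ := hchar 1 (Or.inl rfl) z₀ x₀
  have hX₀' : ∀ z, HasDerivAt X₀ (κ (w (z, X₀ z))) z := fun z => by simpa using hX₀ z
  have hpos₀ : 0 < fderiv ℝ p (z₀, X₀ z₀) (0, 1) + κ (w (z₀, X₀ z₀)) * fderiv ℝ w (z₀, X₀ z₀) (0, 1) := by
    rw [hX₀0, ← hrD]; exact hpos
  obtain ⟨d₀, hd₀, -⟩ := hconv X₀ z₀ hX₀' hpos₀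
  set σ : ℝ := r (z₀, x₀) - 2 * K d₀ with hσdef
  -- `s ∘ X₀ → σ`
  have hsX₀ : Tendsto (fun t => s (t, X₀ t)) atBot (𝓝 σ) := by
    have hrc : ∀ t, r (t, X₀ t) = r (z₀, x₀) := fun t => by
      rw [const_along hr1 hPDE1 hX₀' t z₀, hX₀0]
    have heq : (fun t => s (t, X₀ t)) = fun t => r (z₀, x₀) - 2 * K (w (t, X₀ t)) := by
      funext t; rw [← hrc t, hKrs]; ring
    rw [heq, hσdef]
    exact tendsto_const_nhds.sub (((hKc.tendsto d₀).comp hd₀).const_mul 2)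
  -- KEY: for every `x ∈ (x₀ - ε, x₀]` there is a degenerate value `d` with `2 K d = r(z₀, x) - σ`
  have key : ∀ x, x₀ - ε < x → x ≤ x₀ → ∃ d, κ' d = 0 ∧ 2 * K d = r (z₀, x) - σ := by
    intro x hx1 hx2
    have hrx : 0 < fderiv ℝ r (z₀, x) (0, 1) := hball x (by rw [Real.dist_eq, abs_lt]; constructor <;> linarith)
    obtain ⟨X, hX0, hX⟩ := hchar 1 (Or.inl rfl) z₀ x
    have hX' : ∀ z, HasDerivAt X (κ (w (z, X z))) z := fun z => by simpa using hX z
    have hposx : 0 < fderiv ℝ p (z₀, X z₀) (0, 1) + κ (w (z₀, X z₀)) * fderiv ℝ w (z₀, X z₀) (0, 1) := by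
      rw [hX0, ← hrD]; exact hrx
    obtain ⟨d, hd, hκ'd⟩ := hconv X z₀ hX' hposx
    refine ⟨d, hκ'd, ?_⟩
    -- `X ≤ X₀` everywhere (non-crossing)
    have hle : ∀ z, X z ≤ X₀ z :=
      le_of_le_char (F := fun z x' => (1 : ℝ) * κ (w (z, x'))) (hLip 1 (Or.inl rfl)) hX hX₀ (by rw [hX0, hX₀0]; exact hx2)
    -- `s (z, X z) = s (t*, X₀ t*)` for some `t* ≤ z`
    have hcross : ∀ z, ∃ t ≤ z, s (z, X z) = s (t, X₀ t) := by
      intro z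
      obtain ⟨Y, hY0, hY⟩ := hchar (-1) (Or.inr rfl) z (X z)
      have hY' : ∀ t, HasDerivAt Y (-κ (w (t, Y t))) t := fun t => by simpa using hY t
      obtain ⟨t, ht, hXt⟩ := exists_crossing_below (X := X₀) (Y := Y) hκlo0 hX₀' hY'
        (fun t => hκlo _) (fun t => by linarith [hκlo (t, Y t)]) (by rw [hY0]; exact hle z)
      refine ⟨t, ht, ?_⟩
      -- `s` is constant along `Y`
      have hsc := const_along hs1 hPDE2 (X := Y) hY' z t
      rw [hY0] at hsc
      rw [hsc, ← hXt]
    choose τ hτle hτeq using hcross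
    have hτ : Tendsto τ atBot atBot := tendsto_atBot_mono hτle tendsto_id
    have hsX : Tendsto (fun z => s (z, X z)) atBot (𝓝 σ) := by
      have heq : (fun z => s (z, X z)) = (fun t => s (t, X₀ t)) ∘ τ := by funext z; exact hτeq z
      rw [heq]; exact hsX₀.comp hτ
    -- `2 K (w ∘ X) = r(z₀, x) - s ∘ X → r(z₀, x) - σ`, and also `→ 2 K d`
    have hrc : ∀ t, r (t, X t) = r (z₀, x) := fun t => by rw [const_along hr1 hPDE1 hX' t z₀, hX0]
    have h1 : Tendsto (fun z => 2 * K (w (z, X z))) atBot (𝓝 (r (z₀, x) - σ)) := by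
      have heq : (fun z => 2 * K (w (z, X z))) = fun z => r (z₀, x) - s (z, X z) := by
        funext z; rw [hKrs, hrc]
      rw [heq]; exact tendsto_const_nhds.sub hsX
    have h2 : Tendsto (fun z => 2 * K (w (z, X z))) atBot (𝓝 (2 * K d)) :=
      ((hKc.tendsto d).comp hd).const_mul 2
    exact tendsto_nhds_unique h2 h1
  -- (d) the degenerate values fill an interval
  set x₁ : ℝ := x₀ - ε / 2 with hx₁
  have hx₁lt : x₁ < x₀ := by rw [hx₁]; linarith
  obtain ⟨d₁, hκd₁, hKd₁⟩ := key x₁ (by rw [hx₁]; linarith) hx₁lt.le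
  obtain ⟨d₂, hκd₂, hKd₂⟩ := key x₀ (by linarith) le_rfl
  -- `x ↦ r (z₀, x)` is strictly increasing on `[x₁, x₀]`
  have hρd : ∀ x, HasDerivAt (fun x' => r (z₀, x')) (fderiv ℝ r (z₀, x) (0, 1)) x := by
    intro x
    have hγ : HasDerivAt (fun x' : ℝ => ((z₀, x') : ℝ × ℝ)) ((0 : ℝ), (1 : ℝ)) x :=
      (hasDerivAt_const x z₀).prodMk (hasDerivAt_id x)
    exact (hr1 (z₀, x)).hasFDerivAt.comp_hasDerivAt x hγ
  have hρc : Continuous fun x' => r (z₀, x') := continuous_iff_continuousAt.2 fun x => (hρd x).continuousAt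
  have hρmono : StrictMonoOn (fun x' => r (z₀, x')) (Icc x₁ x₀) := by
    refine strictMonoOn_of_deriv_pos (convex_Icc _ _) hρc.continuousOn fun x hx => ?_
    rw [interior_Icc] at hx
    rw [(hρd x).deriv]
    exact hball x (by rw [Real.dist_eq, abs_lt, hx₁] at *; constructor <;> linarith [hx.1, hx.2])
  have hρlt : r (z₀, x₁) < r (z₀, x₀) :=
    hρmono (left_mem_Icc.2 hx₁lt.le) (right_mem_Icc.2 hx₁lt.le) hx₁lt
  have hd₁d₂ : d₁ < d₂ := by
    by_contra hge
    have := hKmono.monotone (not_lt.1 hge)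
    linarith
  -- every `v ∈ (d₁, d₂)` is some `d_x`, hence degenerate
  obtain ⟨v, hv, hκv⟩ := hgn d₁ d₂ hd₁d₂
  have hKv1 : K d₁ < K v := hKmono hv.1
  have hKv2 : K v < K d₂ := hKmono hv.2
  -- the value `2 K v + σ` is taken by `r (z₀, ·)` on `[x₁, x₀]`
  have hmem : 2 * K v + σ ∈ Icc (r (z₀, x₁)) (r (z₀, x₀)) := ⟨by linarith, by linarith⟩
  obtain ⟨x, hx, hrx⟩ := intermediate_value_Icc hx₁lt.le hρc.continuousOn hmem
  obtain ⟨d, hκd, hKd'⟩ := key x (by rw [hx₁] at hx; linarith [hx.1]) hx.2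
  have hdv : d = v := hKmono.injective (by simp only at hrx; linarith)
  exact hκv (hdv ▸ hκd)

end Summit.NavierStokesRegularity.NavierStokesRegularity.Theorems.PoloidalWindowDoorPoloidalWindowRigidityZShockPSystemNonuniform

end
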